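import Literature.AlgebraicTopology.KTheory.BottSphere
import Literature.AlgebraicTopology.KTheory.Glued
import HarnessLib

/-!
# Bundles over `X × S²` via clutching functions on `X × S¹` (Husemöller, *Fibre Bundles*, Ch. 11 §2)

The clutching description of `K⁰(X × S²)` in the idempotent model, for `X` compact Hausdorff and
`S² = S2r` the round sphere covered by the hemispheres `D₊`, `D₋` (`BottSphere.lean`):

* the closed cover `pieceUp X = X × D₊`, `pieceDn X = X × D₋` of `X × S²`, overlap `X × S¹`
  (compact), the section `sX : x ↦ (x, 1)`, projections `πA`, `πUp`, `πDn`, the coordinate `zA`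
  (`|z| = 1`, `z z̄ = 1`), and the pull-backs `pullA ζ = π^* ζ`, `pullUp`, `pullDn` of an
  idempotent `ζ` over `X`;
* `ClutchingFn ζ` — automorphisms `u` of `im π^* ζ` (with inverse `v`), their invertible
  extensions `ext = u + (1 - Z)`; `IsClutched Q ζ u` — `Q` over `X × S²` carries a gluing witness
  (`Glued.lean`) with local models `π_±^* ζ` and transition `u`;
* **(C1) existence** `exists_isClutched`, **(C2) uniqueness** `IsClutched.algEquivalent`,
  **(C3) universality** `exists_isClutched_of_idem` (Husemöller 11 Prop. 2.3: every bundle over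
  `X × S²` is `[s^*ξ, u]`), the class **`bottClass ζ u = [ζ, u] ∈ K⁰(X × S²)`** and
  `exists_of_eq_bottClass`;
* rules: `bottClass_one` (`[ζ, 1] = pr₁^* ζ`), `bottClass_sum` (`⊕`), `bottClass_tensor` (`⊗`,
  Husemöller 10 Prop. 1.5), naturality `pullback_baseMap_bottClass`, and **homotopy invariance**
  `bottClass_slice_eq` / `bottClass_eq_of_homotopy` (Husemöller 11 (2.6)) via families over `X × [0,1]`;
* re-indexing and base-change machinery for gluing witnesses (`GluingWitness.reindexModels`,
  `reindexTotal`, `castModels`, `comap`).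

Everything is proved; no named facts.

## References

* D. Husemöller, *Fibre Bundles*, 3rd ed. (1994) [HusemollerFibreBundles1994]: Ch. 10 Prop. 1.5,
  §7; Ch. 11 §2 (Notations 2.1, 2.2, 2.7, Prop. 2.3, Example 2.4, (2.6), Cor. 2.8).
* D. Husemöller et al., *Basic Bundle Theory and K-Cohomology Invariants* (2008)
  [HusemollerEtAl2008]: Ch. 3 §7 (clutching construction and its functoriality).
-/

noncomputable section

open Set Metric unitInterval

namespace Literature.AlgebraicTopology.KTheory

open Literature.RingTheory.KTheory Matrix

universe u

variable {X : Type u} [TopologicalSpace X]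

/-! ### The cover of `X × S²` by the two solid pieces -/

variable (X) in
/-- The upper piece `X × D₊ ⊆ X × S²`. [cite: HusemollerFibreBundles1994, Ch. 11 Notation 2.2] -/
abbrev pieceUp : Set (X × S2r) := (univ : Set X) ×ˢ Dup

variable (X) in
/-- The lower piece `X × D₋ ⊆ X × S²`. [cite: HusemollerFibreBundles1994, Ch. 11 Notation 2.2] -/
abbrev pieceDn : Set (X × S2r) := (univ : Set X) ×ˢ Ddn

/-- Auxiliary statement for the clutching description of bundles over X × S². [folklore] -/
theorem isClosed_pieceUp : IsClosed (pieceUp X) := isClosed_univ.prod isClosed_Dup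
/-- Auxiliary statement for the clutching description of bundles over X × S². [folklore] -/
theorem isClosed_pieceDn : IsClosed (pieceDn X) := isClosed_univ.prod isClosed_Ddn

omit [TopologicalSpace X] in
/-- Auxiliary statement for the clutching description of bundles over X × S². [folklore] -/
theorem pieceUp_union_pieceDn : pieceUp X ∪ pieceDn X = univ := by
  rw [pieceUp, pieceDn, ← prod_union, Dup_union_Ddn, univ_prod_univ]

/-- Auxiliary statement for the clutching description of bundles over X × S². -/
instance compactSpace_pieceUp [CompactSpace X] : CompactSpace ↥(pieceUp X) :=
  isCompact_iff_compactSpace.1 isClosed_pieceUp.isCompact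

/-- Auxiliary statement for the clutching description of bundles over X × S². -/
instance compactSpace_pieceDn [CompactSpace X] : CompactSpace ↥(pieceDn X) :=
  isCompact_iff_compactSpace.1 isClosed_pieceDn.isCompact

/-- Auxiliary statement for the clutching description of bundles over X × S². -/
instance compactSpace_overlap [CompactSpace X] : CompactSpace ↥(pieceUp X ∩ pieceDn X) :=
  isCompact_iff_compactSpace.1 (isClosed_pieceUp.inter isClosed_pieceDn).isCompact

omit [TopologicalSpace X] in
/-- Auxiliary statement for the clutching description of bundles over X × S². [folklore] -/
theorem pieceUp_inter_pieceDn : pieceUp X ∩ pieceDn X = (univ : Set X) ×ˢ Eqt := by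
  rw [pieceUp, pieceDn, ← prod_inter, Eqt]

/-- The section `s(x) = (x, 1)` through the base point of the equator. [cite: HusemollerFibreBundles1994, Ch. 11 Notation 2.2] -/
def sX : C(X, X × S2r) := (ContinuousMap.id X).prodMk (ContinuousMap.const X s2Base)

/-- Auxiliary statement for the clutching description of bundles over X × S². [folklore] -/
@[simp] theorem sX_apply (x : X) : sX x = (x, s2Base) := rfl

/-- The projection of the overlap `X × S¹` to `X`. [cite: HusemollerFibreBundles1994, Ch. 11 Notation 2.2] -/
def πA : C(↥(pieceUp X ∩ pieceDn X), X) := ⟨fun z ↦ z.1.1, by fun_prop⟩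

/-- The projection of the upper piece to `X`. [cite: HusemollerFibreBundles1994, Ch. 11 Notation 2.2] -/
def πUp : C(↥(pieceUp X), X) := ⟨fun z ↦ z.1.1, by fun_prop⟩

/-- The projection of the lower piece to `X`. [cite: HusemollerFibreBundles1994, Ch. 11 Notation 2.2] -/
def πDn : C(↥(pieceDn X), X) := ⟨fun z ↦ z.1.1, by fun_prop⟩

/-- The complex coordinate on the overlap `X × S¹`, of modulus one. [cite: HusemollerFibreBundles1994, Ch. 11 Notation 2.1] -/
def zA : C(↥(pieceUp X ∩ pieceDn X), ℂ) := ⟨fun z ↦ zc z.1.2, by fun_prop⟩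

/-- Auxiliary statement for the clutching description of bundles over X × S². [folklore] -/
theorem norm_zA (z : ↥(pieceUp X ∩ pieceDn X)) : ‖zA z‖ = 1 := by
  have hz : z.1 ∈ (univ : Set X) ×ˢ Eqt := by rw [← pieceUp_inter_pieceDn]; exact z.2
  exact norm_zc_of_mem_Eqt hz.2

/-- The conjugate coordinate `z̄ = z⁻¹` on `X × S¹`. [cite: HusemollerFibreBundles1994, Ch. 11 Notation 2.1] -/
def zAbar : C(↥(pieceUp X ∩ pieceDn X), ℂ) := ⟨fun z ↦ (starRingEnd ℂ) (zA z), Complex.continuous_conj.comp zA.continuous⟩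

/-- Auxiliary statement for the clutching description of bundles over X × S². [folklore] -/
@[simp] theorem zAbar_apply (z : ↥(pieceUp X ∩ pieceDn X)) : zAbar z = (starRingEnd ℂ) (zA z) := rfl

/-- `z z̄ = 1` on `X × S¹`: `z` is a unit of `C(X × S¹, ℂ)`. [folklore] -/
theorem zA_mul_zAbar : (zA : C(↥(pieceUp X ∩ pieceDn X), ℂ)) * zAbar = 1 := by
  ext z
  change zA z * (starRingEnd ℂ) (zA z) = 1
  rw [Complex.mul_conj, Complex.normSq_eq_norm_sq, norm_zA]; simp

/-- Auxiliary statement for the clutching description of bundles over X × S². [folklore] -/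
theorem zAbar_mul_zA : (zAbar : C(↥(pieceUp X ∩ pieceDn X), ℂ)) * zA = 1 := by
  rw [mul_comm, zA_mul_zAbar]

/-! ### Pull-backs of an idempotent over `X` to the pieces and the overlap -/

/-- `π^* ζ` on the overlap. [cite: HusemollerFibreBundles1994, Ch. 11 Prop. 2.3] -/
abbrev pullA (ζ : Idem C(X, ℂ)) : Matrix (Fin ζ.size) (Fin ζ.size) C(↥(pieceUp X ∩ pieceDn X), ℂ) :=
  ζ.mat.map (comapRingHom πA)

/-- `π₊^* ζ` on the upper piece. [cite: HusemollerFibreBundles1994, Ch. 11 Prop. 2.3] -/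
abbrev pullUp (ζ : Idem C(X, ℂ)) : Matrix (Fin ζ.size) (Fin ζ.size) C(↥(pieceUp X), ℂ) :=
  ζ.mat.map (comapRingHom πUp)

/-- `π₋^* ζ` on the lower piece. [cite: HusemollerFibreBundles1994, Ch. 11 Prop. 2.3] -/
abbrev pullDn (ζ : Idem C(X, ℂ)) : Matrix (Fin ζ.size) (Fin ζ.size) C(↥(pieceDn X), ℂ) :=
  ζ.mat.map (comapRingHom πDn)

/-- Auxiliary statement for the clutching description of bundles over X × S². [folklore] -/
theorem isIdempotentElem_pullA (ζ : Idem C(X, ℂ)) : IsIdempotentElem (pullA ζ) := by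
  rw [IsIdempotentElem, ← Matrix.map_mul, ζ.isIdempotentElem.eq]

/-- Auxiliary statement for the clutching description of bundles over X × S². [folklore] -/
theorem isIdempotentElem_pullUp (ζ : Idem C(X, ℂ)) : IsIdempotentElem (pullUp ζ) := by
  rw [IsIdempotentElem, ← Matrix.map_mul, ζ.isIdempotentElem.eq]

/-- Auxiliary statement for the clutching description of bundles over X × S². [folklore] -/
theorem isIdempotentElem_pullDn (ζ : Idem C(X, ℂ)) : IsIdempotentElem (pullDn ζ) := by
  rw [IsIdempotentElem, ← Matrix.map_mul, ζ.isIdempotentElem.eq]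

/-- Auxiliary statement for the clutching description of bundles over X × S². [folklore] -/
theorem pullUp_map_ovl₁ (ζ : Idem C(X, ℂ)) : (pullUp ζ).map (ovl₁ (pieceUp X) (pieceDn X)) = pullA ζ := by
  rw [Matrix.map_map]; rfl

/-- Auxiliary statement for the clutching description of bundles over X × S². [folklore] -/
theorem pullDn_map_ovl₂ (ζ : Idem C(X, ℂ)) : (pullDn ζ).map (ovl₂ (pieceUp X) (pieceDn X)) = pullA ζ := by
  rw [Matrix.map_map]; rfl

/-! ### Clutching functions and clutched idempotents -/

/-- **A clutching function** for `ζ` over `X × S¹`: an automorphism `u` of the module `im π^* ζ`,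
written as a matrix with `u = Z u Z` together with an inverse `v` on `im Z` (`Z = π^* ζ`)
(Husemöller, *Fibre Bundles*, Ch. 11 Prop. 2.3: "an automorphism `u : π^*(ζ) → π^*(ζ)`").
[cite: HusemollerFibreBundles1994, Ch. 11 Prop. 2.3] -/
structure ClutchingFn (ζ : Idem C(X, ℂ)) where
  /-- the automorphism of `im π^* ζ` -/
  u : Matrix (Fin ζ.size) (Fin ζ.size) C(↥(pieceUp X ∩ pieceDn X), ℂ)
  /-- its inverse on `im π^* ζ` -/
  v : Matrix (Fin ζ.size) (Fin ζ.size) C(↥(pieceUp X ∩ pieceDn X), ℂ)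
  hu : pullA ζ * u * pullA ζ = u
  hv : pullA ζ * v * pullA ζ = v
  huv : u * v = pullA ζ
  hvu : v * u = pullA ζ

namespace ClutchingFn

variable {ζ : Idem C(X, ℂ)}

/-- Auxiliary statement for the clutching description of bundles over X × S². [folklore] -/
theorem pullA_mul_u (c : ClutchingFn ζ) : pullA ζ * c.u = c.u := by
  conv_lhs => rw [← c.hu]
  rw [← Matrix.mul_assoc, ← Matrix.mul_assoc, (isIdempotentElem_pullA ζ).eq, c.hu]

/-- Auxiliary statement for the clutching description of bundles over X × S². [folklore] -/
theorem u_mul_pullA (c : ClutchingFn ζ) : c.u * pullA ζ = c.u := by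
  conv_lhs => rw [← c.hu]
  rw [Matrix.mul_assoc, (isIdempotentElem_pullA ζ).eq, c.hu]

/-- Auxiliary statement for the clutching description of bundles over X × S². [folklore] -/
theorem pullA_mul_v (c : ClutchingFn ζ) : pullA ζ * c.v = c.v := by
  conv_lhs => rw [← c.hv]
  rw [← Matrix.mul_assoc, ← Matrix.mul_assoc, (isIdempotentElem_pullA ζ).eq, c.hv]

/-- Auxiliary statement for the clutching description of bundles over X × S². [folklore] -/
theorem v_mul_pullA (c : ClutchingFn ζ) : c.v * pullA ζ = c.v := by
  conv_lhs => rw [← c.hv]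
  rw [Matrix.mul_assoc, (isIdempotentElem_pullA ζ).eq, c.hv]

/-- The extension `ũ = u + (1 - Z)` of a clutching function by the identity on the complement:
an honest invertible matrix over `C(X × S¹, ℂ)`. [folklore] -/
def ext (c : ClutchingFn ζ) : Matrix (Fin ζ.size) (Fin ζ.size) C(↥(pieceUp X ∩ pieceDn X), ℂ) := c.u + (1 - pullA ζ)

/-- The inverse `ṽ = v + (1 - Z)` of `ũ`. [folklore] -/
def extInv (c : ClutchingFn ζ) : Matrix (Fin ζ.size) (Fin ζ.size) C(↥(pieceUp X ∩ pieceDn X), ℂ) := c.v + (1 - pullA ζ)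

/-- Auxiliary statement for the clutching description of bundles over X × S². [folklore] -/
theorem ext_mul_extInv (c : ClutchingFn ζ) : c.ext * c.extInv = 1 := by
  have hZ := (isIdempotentElem_pullA ζ).eq
  simp only [ext, extInv, Matrix.add_mul, Matrix.mul_add, Matrix.mul_sub, Matrix.sub_mul, Matrix.mul_one, Matrix.one_mul,
    c.huv, c.u_mul_pullA, c.pullA_mul_v, hZ]
  abel

/-- Auxiliary statement for the clutching description of bundles over X × S². [folklore] -/
theorem extInv_mul_ext (c : ClutchingFn ζ) : c.extInv * c.ext = 1 := by
  have hZ := (isIdempotentElem_pullA ζ).eq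
  simp only [ext, extInv, Matrix.add_mul, Matrix.mul_add, Matrix.mul_sub, Matrix.sub_mul, Matrix.mul_one, Matrix.one_mul,
    c.hvu, c.v_mul_pullA, c.pullA_mul_u, hZ]
  abel

/-- `ũ Z ṽ = Z`: the extended clutching function conjugates `π^* ζ` to itself. [folklore] -/
theorem ext_conj (c : ClutchingFn ζ) : c.ext * pullA ζ * c.extInv = pullA ζ := by
  have hZ := (isIdempotentElem_pullA ζ).eq
  have h1 : c.ext * pullA ζ = c.u := by
    simp only [ext, Matrix.add_mul, Matrix.sub_mul, Matrix.one_mul, hZ, c.u_mul_pullA, sub_self, add_zero]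
  rw [h1]
  simp only [extInv, Matrix.mul_add, Matrix.mul_sub, Matrix.mul_one, c.huv, c.u_mul_pullA, sub_self, add_zero]

end ClutchingFn

/-- **`Q` is clutched from `(ζ, u)`**: the idempotent matrix `Q` over `C(X × S², ℂ)` admits a gluing
witness with local models `π₊^* ζ`, `π₋^* ζ` and transition function `u`
(`Q ≅ π₀^*(ζ) ∪_u π_∞^*(ζ) = [ζ, u]`, Husemöller, Ch. 11 Notation 2.7). [cite: HusemollerFibreBundles1994, Ch. 11 Notation 2.7] -/
def IsClutched {m : Type*} [Fintype m] (Q : Matrix m m C(X × S2r, ℂ)) (ζ : Idem C(X, ℂ)) (c : ClutchingFn ζ) : Prop :=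
  ∃ w : GluingWitness Q (pullUp ζ) (pullDn ζ), w.g = c.u

/-! ### Existence, uniqueness, and universality of clutched idempotents -/

section Main

variable [CompactSpace X] [T2Space X]

omit [CompactSpace X] [T2Space X] in
/-- The incidence `sX ∘ π = incl ∘ sliceRetract` on the upper piece. [folklore] -/
theorem sX_comp_πUp : (sX (X := X)).comp πUp = (incl (pieceUp X)).comp (sliceRetract s2Base s2Base_mem_Dup) := by
  ext z <;> rfl

omit [CompactSpace X] [T2Space X] in
/-- The incidence `sX ∘ π = incl ∘ sliceRetract` on the lower piece. [folklore] -/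
theorem sX_comp_πDn : (sX (X := X)).comp πDn = (incl (pieceDn X)).comp (sliceRetract s2Base s2Base_mem_Ddn) := by
  ext z <;> rfl

/-- **(C1) Existence**: every clutching function of `ζ` is the transition function of some idempotent
over `X × S²` with local models `π_±^* ζ` — the bundle `[ζ, u] = π₀^* ζ ∪_u π_∞^* ζ`
(Husemöller, Ch. 11 Notation 2.7; Ch. 10 §7). [cite: HusemollerFibreBundles1994, Ch. 11 Notation 2.7] -/
theorem exists_isClutched (ζ : Idem C(X, ℂ)) (c : ClutchingFn ζ) :
    ∃ Q : Matrix (Fin ζ.size ⊕ Fin ζ.size) (Fin ζ.size ⊕ Fin ζ.size) C(X × S2r, ℂ), IsClutched Q ζ c := by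
  have hconj : c.ext * (pullUp ζ).map (ovl₁ (pieceUp X) (pieceDn X)) * c.extInv =
      (pullDn ζ).map (ovl₂ (pieceUp X) (pieceDn X)) := by
    rw [pullUp_map_ovl₁, pullDn_map_ovl₂, c.ext_conj]
  obtain ⟨Q, w, hg⟩ := exists_gluingWitness isClosed_pieceUp isClosed_pieceDn pieceUp_union_pieceDn
    (isIdempotentElem_pullUp ζ) (isIdempotentElem_pullDn ζ) c.ext c.extInv c.ext_mul_extInv c.extInv_mul_ext hconj
  refine ⟨Q, w, ?_⟩
  rw [hg, pullUp_map_ovl₁, pullDn_map_ovl₂]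
  have hZ := (isIdempotentElem_pullA ζ).eq
  rw [ClutchingFn.ext, Matrix.mul_add, Matrix.add_mul, Matrix.mul_sub, Matrix.sub_mul, Matrix.mul_one, hZ, hZ, sub_self,
    add_zero, c.hu]

omit [CompactSpace X] [T2Space X] in
/-- **(C2) Uniqueness**: idempotents clutched from the same `(ζ, u)` are algebraically equivalent
(`[ζ, u]` is well defined; Husemöller, Ch. 11 Prop. 2.3, uniqueness). [cite: HusemollerFibreBundles1994, Ch. 11 Prop. 2.3] -/
theorem IsClutched.algEquivalent {m m' : Type*} [Fintype m] [Fintype m'] {Q : Matrix m m C(X × S2r, ℂ)}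
    {Q' : Matrix m' m' C(X × S2r, ℂ)} {ζ : Idem C(X, ℂ)} {c : ClutchingFn ζ}
    (hQ : IsClutched Q ζ c) (hQ' : IsClutched Q' ζ c) : AlgEquivalent Q Q' := by
  obtain ⟨w, hw⟩ := hQ
  obtain ⟨w', hw'⟩ := hQ'
  exact w.algEquivalent_of_g_eq isClosed_pieceUp isClosed_pieceDn pieceUp_union_pieceDn w' (hw.trans hw'.symm)

omit [CompactSpace X] [T2Space X] in
/-- Clutched matrices are idempotent. [folklore] -/
theorem IsClutched.isIdempotentElem {m : Type*} [Fintype m] {Q : Matrix m m C(X × S2r, ℂ)} {ζ : Idem C(X, ℂ)}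
    {c : ClutchingFn ζ} (hQ : IsClutched Q ζ c) : IsIdempotentElem Q := by
  obtain ⟨w, -⟩ := hQ
  exact w.isIdempotentElem pieceUp_union_pieceDn

/-- The clutching function read off from any gluing witness with local models `π_±^* ζ`. [cite: HusemollerFibreBundles1994, Ch. 11 Prop. 2.3] -/
def ClutchingFn.ofWitness {m : Type*} [Fintype m] {Q : Matrix m m C(X × S2r, ℂ)} {ζ : Idem C(X, ℂ)}
    (w : GluingWitness Q (pullUp ζ) (pullDn ζ)) : ClutchingFn ζ where
  u := w.g
  v := w.h
  hu := by
    rw [GluingWitness.g, ← Matrix.mul_assoc]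
    nth_rw 1 [← pullDn_map_ovl₂]
    rw [← Matrix.map_mul, w.P₂_mul_y₂, Matrix.mul_assoc, ← pullUp_map_ovl₁, ← Matrix.map_mul, w.x₁_mul_P₁]
  hv := by
    rw [GluingWitness.h, ← Matrix.mul_assoc]
    nth_rw 1 [← pullUp_map_ovl₁]
    rw [← Matrix.map_mul, w.P₁_mul_y₁, Matrix.mul_assoc, ← pullDn_map_ovl₂, ← Matrix.map_mul, w.x₂_mul_P₂]
  huv := by rw [w.g_mul_h, pullDn_map_ovl₂]
  hvu := by rw [w.h_mul_g, pullUp_map_ovl₁]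

omit [T2Space X] in
/-- **(C3) Universality**: every idempotent over `X × S²` is clutched from its restriction
`ζ = s^* P` along `X × {1}` and the clutching function read off from the trivialisations of
`P|_{X × D_±} ≅ π_±^* s^* P` (Husemöller, Ch. 11 Prop. 2.3: "`ξ` and `π₀^*(ζ) ∪_u π_∞^*(ζ)` are
isomorphic"). [cite: HusemollerFibreBundles1994, Ch. 11 Prop. 2.3] -/
theorem exists_isClutched_of_idem (P : Idem C(X × S2r, ℂ)) :
    ∃ c : ClutchingFn (P.map (comapRingHom sX)), IsClutched P.mat (P.map (comapRingHom sX)) c := by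
  set ζ := P.map (comapRingHom sX)
  -- trivialisations over the two pieces
  have e₁ : AlgEquivalent (P.mat.map (resHom (pieceUp X))) (pullUp ζ) := by
    have h := equiv_map_sliceRetract (X := X) s2Base s2Base_mem_Dup (P.map (resHom (pieceUp X)))
    rw [Idem.map_map, ← comapRingHom_comp, ← sX_comp_πUp, comapRingHom_comp, ← Idem.map_map] at h
    exact Idem.equiv_iff.1 h
  have e₂ : AlgEquivalent (P.mat.map (resHom (pieceDn X))) (pullDn ζ) := by
    have h := equiv_map_sliceRetract (X := X) s2Base s2Base_mem_Ddn (P.map (resHom (pieceDn X)))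
    rw [Idem.map_map, ← comapRingHom_comp, ← sX_comp_πDn, comapRingHom_comp, ← Idem.map_map] at h
    exact Idem.equiv_iff.1 h
  obtain ⟨x₁, y₁, hxy₁, hyx₁, hx₁, hy₁⟩ := e₁
  obtain ⟨x₂, y₂, hxy₂, hyx₂, hx₂, hy₂⟩ := e₂
  let w : GluingWitness P.mat (pullUp ζ) (pullDn ζ) :=
    { x₁ := x₁, y₁ := y₁, x₂ := x₂, y₂ := y₂, hxy₁ := hxy₁, hyx₁ := hyx₁, hx₁ := hx₁, hy₁ := hy₁,
      hxy₂ := hxy₂, hyx₂ := hyx₂, hx₂ := hx₂, hy₂ := hy₂ }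
  exact ⟨ClutchingFn.ofWitness w, w, rfl⟩

/-! ### The class `[ζ, u] ∈ K⁰(X × S²)` -/

/-- **The Bott class `[ζ, u] ∈ K⁰(X × S²)`** of a clutching function: the class of any idempotent
clutched from `(ζ, u)` (Husemöller, Ch. 11 Notation 2.7). [cite: HusemollerFibreBundles1994, Ch. 11 Notation 2.7] -/
def bottClass (ζ : Idem C(X, ℂ)) (c : ClutchingFn ζ) : K0 (X × S2r) :=
  KZero.of (Idem.ofMatrix (Classical.choose (exists_isClutched ζ c))
    (Classical.choose_spec (exists_isClutched ζ c)).isIdempotentElem)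

/-- Any idempotent clutched from `(ζ, u)` represents `[ζ, u]`. [cite: HusemollerFibreBundles1994, Ch. 11 Prop. 2.3] -/
theorem IsClutched.of_ofMatrix_eq {m : Type*} [Fintype m] {Q : Matrix m m C(X × S2r, ℂ)} {ζ : Idem C(X, ℂ)}
    {c : ClutchingFn ζ} (hQ : IsClutched Q ζ c) :
    KZero.of (Idem.ofMatrix Q hQ.isIdempotentElem) = bottClass ζ c := by
  apply KZero.of_eq_of
  refine (Idem.algEquivalent_ofMatrix Q hQ.isIdempotentElem).trans ?_
  exact (hQ.algEquivalent (Classical.choose_spec (exists_isClutched ζ c))).trans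
    (Idem.algEquivalent_ofMatrix _ _).symm

/-- A `Fin`-indexed clutched idempotent represents `[ζ, u]`. [cite: HusemollerFibreBundles1994, Ch. 11 Prop. 2.3] -/
theorem IsClutched.of_eq (q : Idem C(X × S2r, ℂ)) {ζ : Idem C(X, ℂ)} {c : ClutchingFn ζ} (hq : IsClutched q.mat ζ c) :
    KZero.of q = bottClass ζ c := by
  rw [← hq.of_ofMatrix_eq]
  exact KZero.of_eq_of (Idem.algEquivalent_ofMatrix q.mat hq.isIdempotentElem).symm

/-- **Every class in `K⁰(X × S²)` represented by an idempotent `P` is a Bott class**: `[P] = [s^* P, u]`.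
[cite: HusemollerFibreBundles1994, Ch. 11 Prop. 2.3] -/
theorem exists_of_eq_bottClass (P : Idem C(X × S2r, ℂ)) :
    ∃ c : ClutchingFn (P.map (comapRingHom sX)), KZero.of P = bottClass (P.map (comapRingHom sX)) c := by
  obtain ⟨c, hc⟩ := exists_isClutched_of_idem P
  exact ⟨c, hc.of_eq P⟩

end Main

/-! ### Re-indexing gluing witnesses -/

section Reindex

variable {R : Type*} [CommRing R] {ι κ : Type*} [Fintype ι] [Fintype κ]

omit [TopologicalSpace X] in
/-- `M (N.submatrix id f) = (M N).submatrix id f`. [folklore] -/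
theorem mul_submatrix_id {a b c d : Type*} [Fintype b] (M : Matrix a b R) (N : Matrix b c R) (f : d → c) :
    M * N.submatrix id f = (M * N).submatrix id f := by
  ext i j; simp [Matrix.mul_apply]

omit [TopologicalSpace X] in
/-- `(M.submatrix f id) N = (M N).submatrix f id`. [folklore] -/
theorem submatrix_id_mul {a b c d : Type*} [Fintype b] (M : Matrix a b R) (f : d → a) (N : Matrix b c R) :
    M.submatrix f id * N = (M * N).submatrix f id := by
  ext i j; simp [Matrix.mul_apply]

omit [TopologicalSpace X] in
/-- `P.submatrix id e⁻¹ · P.submatrix e⁻¹ id = P` for an idempotent `P`. [folklore] -/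
theorem submatrix_witness_cd {P : Matrix ι ι R} (hP : IsIdempotentElem P) (e : ι ≃ κ) :
    P.submatrix id e.symm * P.submatrix e.symm id = P := by
  rw [Matrix.submatrix_mul_equiv, hP.eq, Matrix.submatrix_id_id]

omit [TopologicalSpace X] [Fintype κ] in
/-- `P.submatrix e⁻¹ id · P.submatrix id e⁻¹ = reindex e e P` for an idempotent `P`. [folklore] -/
theorem submatrix_witness_dc {P : Matrix ι ι R} (hP : IsIdempotentElem P) (e : ι ≃ κ) :
    P.submatrix e.symm id * P.submatrix id e.symm = Matrix.reindex e e P := by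
  rw [submatrix_id_mul, mul_submatrix_id, hP.eq, Matrix.submatrix_submatrix, Matrix.reindex_apply]; rfl

omit [TopologicalSpace X] in
/-- Normalisation of the re-indexing witness. [folklore] -/
theorem submatrix_witness_dcd {P : Matrix ι ι R} (hP : IsIdempotentElem P) (e : ι ≃ κ) :
    P.submatrix e.symm id * P.submatrix id e.symm * P.submatrix e.symm id = P.submatrix e.symm id := by
  rw [Matrix.mul_assoc, submatrix_witness_cd hP, submatrix_id_mul, hP.eq]

omit [TopologicalSpace X] in
/-- Normalisation of the re-indexing witness (other side). [folklore] -/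
theorem submatrix_witness_cdc {P : Matrix ι ι R} (hP : IsIdempotentElem P) (e : ι ≃ κ) :
    P.submatrix id e.symm * P.submatrix e.symm id * P.submatrix id e.symm = P.submatrix id e.symm := by
  rw [submatrix_witness_cd hP, mul_submatrix_id, hP.eq]

end Reindex

namespace GluingWitness

variable {Y : Type*} [TopologicalSpace Y] {Y₁ Y₂ : Set Y}
variable {m n₁ n₂ : Type*} [Fintype m] [Fintype n₁] [Fintype n₂]
variable {Q : Matrix m m C(Y, ℂ)} {P₁ : Matrix n₁ n₁ C(Y₁, ℂ)} {P₂ : Matrix n₂ n₂ C(Y₂, ℂ)}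

/-- Re-index the local models of a gluing witness (a change of local models by re-indexing
witnesses). [folklore] -/
def reindexModels {n₁' n₂' : Type*} [Fintype n₁'] [Fintype n₂'] (w : GluingWitness Q P₁ P₂) (e₁ : n₁ ≃ n₁') (e₂ : n₂ ≃ n₂') :
    GluingWitness Q (Matrix.reindex e₁ e₁ P₁) (Matrix.reindex e₂ e₂ P₂) :=
  w.reframe (P₁.submatrix id e₁.symm) (P₁.submatrix e₁.symm id) (submatrix_witness_cd w.isIdempotentElem₁ e₁)
    (submatrix_witness_dc w.isIdempotentElem₁ e₁) (submatrix_witness_dcd w.isIdempotentElem₁ e₁)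
    (P₂.submatrix id e₂.symm) (P₂.submatrix e₂.symm id) (submatrix_witness_cd w.isIdempotentElem₂ e₂)
    (submatrix_witness_dc w.isIdempotentElem₂ e₂) (submatrix_witness_dcd w.isIdempotentElem₂ e₂)

/-- The transition after re-indexing the models is the re-indexed transition. [folklore] -/
theorem g_reindexModels {n₁' n₂' : Type*} [Fintype n₁'] [Fintype n₂'] (w : GluingWitness Q P₁ P₂) (e₁ : n₁ ≃ n₁') (e₂ : n₂ ≃ n₂') :
    (w.reindexModels e₁ e₂).g = Matrix.reindex e₂ e₁ w.g := by
  rw [reindexModels, g_reframe, ← Matrix.submatrix_map, ← Matrix.submatrix_map, submatrix_id_mul, mul_submatrix_id,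
    submatrix_id_mul, Matrix.submatrix_submatrix, Matrix.reindex_apply, GluingWitness.g, ← Matrix.mul_assoc, ← Matrix.map_mul,
    w.P₂_mul_y₂, Matrix.mul_assoc, ← Matrix.map_mul, w.x₁_mul_P₁]
  rfl

/-- Re-index the glued matrix of a gluing witness; the transition function is unchanged. [folklore] -/
def reindexTotal {m' : Type*} [Fintype m'] (w : GluingWitness Q P₁ P₂) (hQ : IsIdempotentElem Q) (e : m ≃ m') :
    GluingWitness (Matrix.reindex e e Q) P₁ P₂ :=
  w.ofAlgEquivalent (Q.submatrix e.symm id) (Q.submatrix id e.symm) (submatrix_witness_dc hQ e) (submatrix_witness_cd hQ e)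
    (submatrix_witness_dcd hQ e)

/-- Re-indexing the glued matrix does not change the transition. [folklore] -/
theorem g_reindexTotal {m' : Type*} [Fintype m'] (w : GluingWitness Q P₁ P₂) (hQ : IsIdempotentElem Q) (e : m ≃ m') :
    (w.reindexTotal hQ e).g = w.g :=
  w.g_ofAlgEquivalent _ _ _ _ _

end GluingWitness

/-- **Clutchedness is invariant under re-indexing the glued matrix.** [folklore] -/
theorem IsClutched.reindex [CompactSpace X] [T2Space X] {m m' : Type*} [Fintype m] [Fintype m'] {Q : Matrix m m C(X × S2r, ℂ)}
    {ζ : Idem C(X, ℂ)} {c : ClutchingFn ζ} (hQ : IsClutched Q ζ c) (e : m ≃ m') : IsClutched (Matrix.reindex e e Q) ζ c := by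
  obtain ⟨w, hw⟩ := hQ
  exact ⟨w.reindexTotal (w.isIdempotentElem pieceUp_union_pieceDn) e, (w.g_reindexTotal _ e).trans hw⟩

/-! ### The trivial clutching: `[ζ, 1] = pr₁^* ζ` -/

section Trivial

variable (X) in
/-- The projection `X × S² → X`. [cite: HusemollerFibreBundles1994, Ch. 11 Notation 2.2] -/
abbrev prX : C(X × S2r, X) := ContinuousMap.fst

variable (X) in
/-- The projection `X × S² → S²`. [cite: HusemollerFibreBundles1994, Ch. 11 Notation 2.2] -/
abbrev prS : C(X × S2r, S2r) := ContinuousMap.snd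

/-- The identity clutching function `u = 1` of `im π^* ζ`. [cite: HusemollerFibreBundles1994, Ch. 11 Notation 2.7] -/
def ClutchingFn.one (ζ : Idem C(X, ℂ)) : ClutchingFn ζ where
  u := pullA ζ
  v := pullA ζ
  hu := by rw [(isIdempotentElem_pullA ζ).eq, (isIdempotentElem_pullA ζ).eq]
  hv := by rw [(isIdempotentElem_pullA ζ).eq, (isIdempotentElem_pullA ζ).eq]
  huv := (isIdempotentElem_pullA ζ).eq
  hvu := (isIdempotentElem_pullA ζ).eq

/-- Auxiliary statement for the clutching description of bundles over X × S². [folklore] -/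
theorem prX_comp_incl_pieceUp : (prX X).comp (incl (pieceUp X)) = πUp := by ext z; rfl
/-- Auxiliary statement for the clutching description of bundles over X × S². [folklore] -/
theorem prX_comp_incl_pieceDn : (prX X).comp (incl (pieceDn X)) = πDn := by ext z; rfl

/-- `(pr₁^* ζ)|_{X × D₊} = π₊^* ζ`. [folklore] -/
theorem map_prX_map_resHom_pieceUp (ζ : Idem C(X, ℂ)) :
    (ζ.mat.map (comapRingHom (prX X))).map (resHom (pieceUp X)) = pullUp ζ := by
  rw [Matrix.map_map, resHom, ← RingHom.coe_comp, ← comapRingHom_comp, prX_comp_incl_pieceUp]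

/-- `(pr₁^* ζ)|_{X × D₋} = π₋^* ζ`. [folklore] -/
theorem map_prX_map_resHom_pieceDn (ζ : Idem C(X, ℂ)) :
    (ζ.mat.map (comapRingHom (prX X))).map (resHom (pieceDn X)) = pullDn ζ := by
  rw [Matrix.map_map, resHom, ← RingHom.coe_comp, ← comapRingHom_comp, prX_comp_incl_pieceDn]

/-- **`pr₁^* ζ` is clutched from `(ζ, 1)`** (tautological witness). [cite: HusemollerFibreBundles1994, Ch. 11 Notation 2.7] -/
theorem isClutched_map_prX (ζ : Idem C(X, ℂ)) : IsClutched (ζ.mat.map (comapRingHom (prX X))) ζ (ClutchingFn.one ζ) := by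
  have h₁ := (isIdempotentElem_pullUp ζ).eq
  have h₂ := (isIdempotentElem_pullDn ζ).eq
  refine ⟨{ x₁ := pullUp ζ, y₁ := pullUp ζ, x₂ := pullDn ζ, y₂ := pullDn ζ,
            hxy₁ := by rw [map_prX_map_resHom_pieceUp, h₁], hyx₁ := h₁, hx₁ := by rw [h₁, h₁], hy₁ := by rw [h₁, h₁],
            hxy₂ := by rw [map_prX_map_resHom_pieceDn, h₂], hyx₂ := h₂, hx₂ := by rw [h₂, h₂], hy₂ := by rw [h₂, h₂] }, ?_⟩
  change (pullDn ζ).map (ovl₂ (pieceUp X) (pieceDn X)) * (pullUp ζ).map (ovl₁ (pieceUp X) (pieceDn X)) = pullA ζ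
  rw [pullDn_map_ovl₂, pullUp_map_ovl₁, (isIdempotentElem_pullA ζ).eq]

/-- **`[ζ, 1] = pr₁^* [ζ]`** in `K⁰(X × S²)`. [cite: HusemollerFibreBundles1994, Ch. 11 Notation 2.7] -/
theorem bottClass_one [CompactSpace X] [T2Space X] (ζ : Idem C(X, ℂ)) :
    bottClass ζ (ClutchingFn.one ζ) = pullback (prX X) (KZero.of ζ) := by
  rw [pullback_of]
  exact ((isClutched_map_prX ζ).of_eq (ζ.map (comapRingHom (prX X)))).symm

end Trivial

/-! ### Direct sums of clutching functions: `[ζ ⊕ ζ', u ⊕ u'] = [ζ, u] + [ζ', u']` -/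

section Sum

omit [TopologicalSpace X] in
/-- Products of re-indexed matrices. [folklore] -/
theorem reindex_mul_reindex {R : Type*} [CommRing R] {ι κ : Type*} [Fintype ι] [Fintype κ] (e : ι ≃ κ)
    (M N : Matrix ι ι R) : Matrix.reindex e e M * Matrix.reindex e e N = Matrix.reindex e e (M * N) := by
  simp only [Matrix.reindex_apply, Matrix.submatrix_mul_equiv]

/-- `π^*(ζ ⊕ ζ') = π^* ζ ⊕ π^* ζ'` (re-indexed block sum) on the overlap. [folklore] -/
theorem pullA_add (ζ ζ' : Idem C(X, ℂ)) :
    pullA (ζ + ζ') = Matrix.reindex finSumFinEquiv finSumFinEquiv (Matrix.fromBlocks (pullA ζ) 0 0 (pullA ζ')) := by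
  change ((Matrix.reindex _ _ (Matrix.fromBlocks ζ.mat 0 0 ζ'.mat)).map _) = _
  rw [Matrix.reindex_apply, Matrix.reindex_apply, ← Matrix.submatrix_map, Matrix.fromBlocks_map, Matrix.map_zero _ (map_zero _),
    Matrix.map_zero _ (map_zero _)]
  rfl

/-- `π₊^*(ζ ⊕ ζ') = π₊^* ζ ⊕ π₊^* ζ'`. [folklore] -/
theorem pullUp_add (ζ ζ' : Idem C(X, ℂ)) :
    pullUp (ζ + ζ') = Matrix.reindex finSumFinEquiv finSumFinEquiv (Matrix.fromBlocks (pullUp ζ) 0 0 (pullUp ζ')) := by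
  change ((Matrix.reindex _ _ (Matrix.fromBlocks ζ.mat 0 0 ζ'.mat)).map _) = _
  rw [Matrix.reindex_apply, Matrix.reindex_apply, ← Matrix.submatrix_map, Matrix.fromBlocks_map, Matrix.map_zero _ (map_zero _),
    Matrix.map_zero _ (map_zero _)]
  rfl

/-- `π₋^*(ζ ⊕ ζ') = π₋^* ζ ⊕ π₋^* ζ'`. [folklore] -/
theorem pullDn_add (ζ ζ' : Idem C(X, ℂ)) :
    pullDn (ζ + ζ') = Matrix.reindex finSumFinEquiv finSumFinEquiv (Matrix.fromBlocks (pullDn ζ) 0 0 (pullDn ζ')) := by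
  change ((Matrix.reindex _ _ (Matrix.fromBlocks ζ.mat 0 0 ζ'.mat)).map _) = _
  rw [Matrix.reindex_apply, Matrix.reindex_apply, ← Matrix.submatrix_map, Matrix.fromBlocks_map, Matrix.map_zero _ (map_zero _),
    Matrix.map_zero _ (map_zero _)]
  rfl

/-- Block computation for `ClutchingFn.sum` (stated at the normalised index type). [folklore] -/
theorem ClutchingFn.sum_aux₁ {ζ ζ' : Idem C(X, ℂ)} (Z u Z₂ : Matrix (Fin ζ.size) (Fin ζ.size) C(↥(pieceUp X ∩ pieceDn X), ℂ))
    (Z' u' Z₂' : Matrix (Fin ζ'.size) (Fin ζ'.size) C(↥(pieceUp X ∩ pieceDn X), ℂ)) :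
    Matrix.reindex finSumFinEquiv finSumFinEquiv (Matrix.fromBlocks Z 0 0 Z') *
        Matrix.reindex finSumFinEquiv finSumFinEquiv (Matrix.fromBlocks u 0 0 u') *
          Matrix.reindex finSumFinEquiv finSumFinEquiv (Matrix.fromBlocks Z₂ 0 0 Z₂') =
      Matrix.reindex finSumFinEquiv finSumFinEquiv (Matrix.fromBlocks (Z * u * Z₂) 0 0 (Z' * u' * Z₂')) := by
  rw [reindex_mul_reindex, reindex_mul_reindex, Matrix.fromBlocks_multiply, Matrix.fromBlocks_multiply]; simp

/-- Block computation for `ClutchingFn.sum` (two factors). [folklore] -/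
theorem ClutchingFn.sum_aux₂ {ζ ζ' : Idem C(X, ℂ)} (u v : Matrix (Fin ζ.size) (Fin ζ.size) C(↥(pieceUp X ∩ pieceDn X), ℂ))
    (u' v' : Matrix (Fin ζ'.size) (Fin ζ'.size) C(↥(pieceUp X ∩ pieceDn X), ℂ)) :
    Matrix.reindex finSumFinEquiv finSumFinEquiv (Matrix.fromBlocks u 0 0 u') *
        Matrix.reindex finSumFinEquiv finSumFinEquiv (Matrix.fromBlocks v 0 0 v') =
      Matrix.reindex finSumFinEquiv finSumFinEquiv (Matrix.fromBlocks (u * v) 0 0 (u' * v')) := by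
  rw [reindex_mul_reindex, Matrix.fromBlocks_multiply]; simp

/-- **Direct sum of clutching functions** `u ⊕ u'` for `ζ ⊕ ζ'` (Husemöller, Ch. 10 Prop. 1.5:
`(ξ/t) ⊕ (ξ'/t') ≅ (ξ ⊕ ξ')/(t ⊕ t')`). [cite: HusemollerFibreBundles1994, Ch. 10 Prop. 1.5] -/
def ClutchingFn.sum {ζ ζ' : Idem C(X, ℂ)} (c : ClutchingFn ζ) (c' : ClutchingFn ζ') : ClutchingFn (ζ + ζ') where
  u := Matrix.reindex finSumFinEquiv finSumFinEquiv (Matrix.fromBlocks c.u 0 0 c'.u)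
  v := Matrix.reindex finSumFinEquiv finSumFinEquiv (Matrix.fromBlocks c.v 0 0 c'.v)
  hu := by rw [pullA_add]; exact (ClutchingFn.sum_aux₁ _ _ _ _ _ _).trans (by rw [c.hu, c'.hu])
  hv := by rw [pullA_add]; exact (ClutchingFn.sum_aux₁ _ _ _ _ _ _).trans (by rw [c.hv, c'.hv])
  huv := by rw [pullA_add]; exact (ClutchingFn.sum_aux₂ _ _ _ _).trans (by rw [c.huv, c'.huv])
  hvu := by rw [pullA_add]; exact (ClutchingFn.sum_aux₂ _ _ _ _).trans (by rw [c.hvu, c'.hvu])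

/-- Transport a gluing witness along equalities of the local models (same index types). [folklore] -/
def GluingWitness.castModels {Y : Type*} [TopologicalSpace Y] {Y₁ Y₂ : Set Y} {m n₁ n₂ : Type*} [Fintype m] [Fintype n₁] [Fintype n₂]
    {Q : Matrix m m C(Y, ℂ)} {P₁ P₁' : Matrix n₁ n₁ C(Y₁, ℂ)} {P₂ P₂' : Matrix n₂ n₂ C(Y₂, ℂ)}
    (w : GluingWitness Q P₁ P₂) (h₁ : P₁ = P₁') (h₂ : P₂ = P₂') : GluingWitness Q P₁' P₂' where
  x₁ := w.x₁
  y₁ := w.y₁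
  x₂ := w.x₂
  y₂ := w.y₂
  hxy₁ := w.hxy₁
  hyx₁ := h₁ ▸ w.hyx₁
  hx₁ := w.hx₁
  hy₁ := w.hy₁
  hxy₂ := w.hxy₂
  hyx₂ := h₂ ▸ w.hyx₂
  hx₂ := w.hx₂
  hy₂ := w.hy₂

/-- Auxiliary statement for the clutching description of bundles over X × S². [folklore] -/
theorem GluingWitness.g_castModels {Y : Type*} [TopologicalSpace Y] {Y₁ Y₂ : Set Y} {m n₁ n₂ : Type*} [Fintype m] [Fintype n₁]
    [Fintype n₂] {Q : Matrix m m C(Y, ℂ)} {P₁ P₁' : Matrix n₁ n₁ C(Y₁, ℂ)} {P₂ P₂' : Matrix n₂ n₂ C(Y₂, ℂ)}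
    (w : GluingWitness Q P₁ P₂) (h₁ : P₁ = P₁') (h₂ : P₂ = P₂') : (w.castModels h₁ h₂).g = w.g := rfl

variable [CompactSpace X] [T2Space X]

omit [CompactSpace X] [T2Space X] in
/-- **Clutched idempotents add**: `Q ⊕ Q'` is clutched from `(ζ ⊕ ζ', u ⊕ u')`.
[cite: HusemollerFibreBundles1994, Ch. 10 Prop. 1.5] -/
theorem IsClutched.sum {m m' : Type*} [Fintype m] [Fintype m'] {Q : Matrix m m C(X × S2r, ℂ)} {Q' : Matrix m' m' C(X × S2r, ℂ)}
    {ζ ζ' : Idem C(X, ℂ)} {c : ClutchingFn ζ} {c' : ClutchingFn ζ'} (hQ : IsClutched Q ζ c) (hQ' : IsClutched Q' ζ' c') :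
    IsClutched (Matrix.fromBlocks Q 0 0 Q') (ζ + ζ') (c.sum c') := by
  obtain ⟨w, hw⟩ := hQ
  obtain ⟨w', hw'⟩ := hQ'
  refine ⟨((w.sum w').reindexModels finSumFinEquiv finSumFinEquiv).castModels (pullUp_add ζ ζ').symm (pullDn_add ζ ζ').symm, ?_⟩
  change ((w.sum w').reindexModels finSumFinEquiv finSumFinEquiv).g =
    Matrix.reindex finSumFinEquiv finSumFinEquiv (Matrix.fromBlocks c.u 0 0 c'.u)
  rw [GluingWitness.g_reindexModels, GluingWitness.g_sum, hw, hw']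

/-- **`[ζ ⊕ ζ', u ⊕ u'] = [ζ, u] + [ζ', u']`** in `K⁰(X × S²)`. [cite: HusemollerFibreBundles1994, Ch. 10 Prop. 1.5] -/
theorem bottClass_sum {ζ ζ' : Idem C(X, ℂ)} (c : ClutchingFn ζ) (c' : ClutchingFn ζ') :
    bottClass (ζ + ζ') (c.sum c') = bottClass ζ c + bottClass ζ' c' := by
  -- representatives
  set q : Idem C(X × S2r, ℂ) := Idem.ofMatrix _ (Classical.choose_spec (exists_isClutched ζ c)).isIdempotentElem
  set q' : Idem C(X × S2r, ℂ) := Idem.ofMatrix _ (Classical.choose_spec (exists_isClutched ζ' c')).isIdempotentElem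
  have hq : IsClutched q.mat ζ c := (Classical.choose_spec (exists_isClutched ζ c)).reindex _
  have hq' : IsClutched q'.mat ζ' c' := (Classical.choose_spec (exists_isClutched ζ' c')).reindex _
  have hsum : IsClutched (q + q').mat (ζ + ζ') (c.sum c') := (hq.sum hq').reindex _
  rw [← hsum.of_eq, KZero.of_add, hq.of_eq, hq'.of_eq]

end Sum

/-! ### Tensor products of clutching functions: `[ζ ⊗ ζ', u ⊗ u'] = [ζ, u] · [ζ', u']` -/

section Tensor

open Kronecker

/-- `π^*(ζ ⊗ ζ') = π^* ζ ⊗ π^* ζ'` (re-indexed Kronecker product) on the overlap. [folklore] -/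
theorem pullA_mul (ζ ζ' : Idem C(X, ℂ)) :
    pullA (ζ * ζ') = Matrix.reindex finProdFinEquiv finProdFinEquiv (pullA ζ ⊗ₖ pullA ζ') := by
  change ((Matrix.reindex _ _ (ζ.mat ⊗ₖ ζ'.mat)).map _) = _
  rw [Matrix.reindex_apply, Matrix.reindex_apply, ← Matrix.submatrix_map, kronecker_map_ringHom]
  rfl

/-- `π₊^*(ζ ⊗ ζ') = π₊^* ζ ⊗ π₊^* ζ'`. [folklore] -/
theorem pullUp_mul (ζ ζ' : Idem C(X, ℂ)) :
    pullUp (ζ * ζ') = Matrix.reindex finProdFinEquiv finProdFinEquiv (pullUp ζ ⊗ₖ pullUp ζ') := by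
  change ((Matrix.reindex _ _ (ζ.mat ⊗ₖ ζ'.mat)).map _) = _
  rw [Matrix.reindex_apply, Matrix.reindex_apply, ← Matrix.submatrix_map, kronecker_map_ringHom]
  rfl

/-- `π₋^*(ζ ⊗ ζ') = π₋^* ζ ⊗ π₋^* ζ'`. [folklore] -/
theorem pullDn_mul (ζ ζ' : Idem C(X, ℂ)) :
    pullDn (ζ * ζ') = Matrix.reindex finProdFinEquiv finProdFinEquiv (pullDn ζ ⊗ₖ pullDn ζ') := by
  change ((Matrix.reindex _ _ (ζ.mat ⊗ₖ ζ'.mat)).map _) = _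
  rw [Matrix.reindex_apply, Matrix.reindex_apply, ← Matrix.submatrix_map, kronecker_map_ringHom]
  rfl

/-- Kronecker computation for `ClutchingFn.tensor` (three factors, normalised index type). [folklore] -/
theorem ClutchingFn.tensor_aux₁ {ζ ζ' : Idem C(X, ℂ)} (Z u Z₂ : Matrix (Fin ζ.size) (Fin ζ.size) C(↥(pieceUp X ∩ pieceDn X), ℂ))
    (Z' u' Z₂' : Matrix (Fin ζ'.size) (Fin ζ'.size) C(↥(pieceUp X ∩ pieceDn X), ℂ)) :
    Matrix.reindex finProdFinEquiv finProdFinEquiv (Z ⊗ₖ Z') * Matrix.reindex finProdFinEquiv finProdFinEquiv (u ⊗ₖ u') *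
        Matrix.reindex finProdFinEquiv finProdFinEquiv (Z₂ ⊗ₖ Z₂') =
      Matrix.reindex finProdFinEquiv finProdFinEquiv ((Z * u * Z₂) ⊗ₖ (Z' * u' * Z₂')) := by
  rw [reindex_mul_reindex, reindex_mul_reindex, ← Matrix.mul_kronecker_mul, ← Matrix.mul_kronecker_mul]

/-- Kronecker computation for `ClutchingFn.tensor` (two factors). [folklore] -/
theorem ClutchingFn.tensor_aux₂ {ζ ζ' : Idem C(X, ℂ)} (u v : Matrix (Fin ζ.size) (Fin ζ.size) C(↥(pieceUp X ∩ pieceDn X), ℂ))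
    (u' v' : Matrix (Fin ζ'.size) (Fin ζ'.size) C(↥(pieceUp X ∩ pieceDn X), ℂ)) :
    Matrix.reindex finProdFinEquiv finProdFinEquiv (u ⊗ₖ u') * Matrix.reindex finProdFinEquiv finProdFinEquiv (v ⊗ₖ v') =
      Matrix.reindex finProdFinEquiv finProdFinEquiv ((u * v) ⊗ₖ (u' * v')) := by
  rw [reindex_mul_reindex, ← Matrix.mul_kronecker_mul]

/-- **Tensor product of clutching functions** `u ⊗ u'` for `ζ ⊗ ζ'` (Husemöller, Ch. 10 Prop. 1.5:
`(ξ/t) ⊗ (ξ'/t') ≅ (ξ ⊗ ξ')/(t ⊗ t')`). [cite: HusemollerFibreBundles1994, Ch. 10 Prop. 1.5] -/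
def ClutchingFn.tensor {ζ ζ' : Idem C(X, ℂ)} (c : ClutchingFn ζ) (c' : ClutchingFn ζ') : ClutchingFn (ζ * ζ') where
  u := Matrix.reindex finProdFinEquiv finProdFinEquiv (c.u ⊗ₖ c'.u)
  v := Matrix.reindex finProdFinEquiv finProdFinEquiv (c.v ⊗ₖ c'.v)
  hu := by rw [pullA_mul]; exact (ClutchingFn.tensor_aux₁ _ _ _ _ _ _).trans (by rw [c.hu, c'.hu])
  hv := by rw [pullA_mul]; exact (ClutchingFn.tensor_aux₁ _ _ _ _ _ _).trans (by rw [c.hv, c'.hv])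
  huv := by rw [pullA_mul]; exact (ClutchingFn.tensor_aux₂ _ _ _ _).trans (by rw [c.huv, c'.huv])
  hvu := by rw [pullA_mul]; exact (ClutchingFn.tensor_aux₂ _ _ _ _).trans (by rw [c.hvu, c'.hvu])

/-- Auxiliary statement for the clutching description of bundles over X × S². [folklore] -/
theorem ClutchingFn.tensor_u {ζ ζ' : Idem C(X, ℂ)} (c : ClutchingFn ζ) (c' : ClutchingFn ζ') :
    (c.tensor c').u = Matrix.reindex finProdFinEquiv finProdFinEquiv (c.u ⊗ₖ c'.u) := rfl

/-- **Clutched idempotents multiply**: `Q ⊗ Q'` is clutched from `(ζ ⊗ ζ', u ⊗ u')`.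
[cite: HusemollerFibreBundles1994, Ch. 10 Prop. 1.5] -/
theorem IsClutched.tensor {m m' : Type*} [Fintype m] [Fintype m'] {Q : Matrix m m C(X × S2r, ℂ)} {Q' : Matrix m' m' C(X × S2r, ℂ)}
    {ζ ζ' : Idem C(X, ℂ)} {c : ClutchingFn ζ} {c' : ClutchingFn ζ'} (hQ : IsClutched Q ζ c) (hQ' : IsClutched Q' ζ' c') :
    IsClutched (Q ⊗ₖ Q') (ζ * ζ') (c.tensor c') := by
  obtain ⟨w, hw⟩ := hQ
  obtain ⟨w', hw'⟩ := hQ'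
  refine ⟨((w.kronecker w').reindexModels finProdFinEquiv finProdFinEquiv).castModels (pullUp_mul ζ ζ').symm (pullDn_mul ζ ζ').symm, ?_⟩
  change ((w.kronecker w').reindexModels finProdFinEquiv finProdFinEquiv).g =
    Matrix.reindex finProdFinEquiv finProdFinEquiv (c.u ⊗ₖ c'.u)
  rw [GluingWitness.g_reindexModels, GluingWitness.g_kronecker, hw, hw']

variable [CompactSpace X] [T2Space X]

/-- **`[ζ ⊗ ζ', u ⊗ u'] = [ζ, u] · [ζ', u']`** in the ring `K⁰(X × S²)`. [cite: HusemollerFibreBundles1994, Ch. 10 Prop. 1.5] -/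
theorem bottClass_tensor {ζ ζ' : Idem C(X, ℂ)} (c : ClutchingFn ζ) (c' : ClutchingFn ζ') :
    bottClass (ζ * ζ') (c.tensor c') = bottClass ζ c * bottClass ζ' c' := by
  set q : Idem C(X × S2r, ℂ) := Idem.ofMatrix _ (Classical.choose_spec (exists_isClutched ζ c)).isIdempotentElem
  set q' : Idem C(X × S2r, ℂ) := Idem.ofMatrix _ (Classical.choose_spec (exists_isClutched ζ' c')).isIdempotentElem
  have hq : IsClutched q.mat ζ c := (Classical.choose_spec (exists_isClutched ζ c)).reindex _
  have hq' : IsClutched q'.mat ζ' c' := (Classical.choose_spec (exists_isClutched ζ' c')).reindex _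
  have hmul : IsClutched (q * q').mat (ζ * ζ') (c.tensor c') := (hq.tensor hq').reindex _
  rw [← hmul.of_eq, ← hq.of_eq, ← hq'.of_eq]
  exact (KZero.of_mul_of q q').symm

end Tensor

/-! ### Base change of gluing witnesses and clutching functions -/

section BaseChange

variable {Y Y' : Type*} [TopologicalSpace Y] [TopologicalSpace Y'] {Y₁ Y₂ : Set Y} {Y₁' Y₂' : Set Y'}

omit [TopologicalSpace X] in
/-- Restriction of a map of pairs to the pieces. [folklore] -/
def restrictMap (F : C(Y', Y)) {S' : Set Y'} {S : Set Y} (h : MapsTo F S' S) : C(S', S) :=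
  ⟨fun z ↦ ⟨F z, h z.2⟩, by fun_prop⟩

omit [TopologicalSpace X] in
/-- Auxiliary statement for the clutching description of bundles over X × S². [folklore] -/
@[simp] theorem restrictMap_apply (F : C(Y', Y)) {S' : Set Y'} {S : Set Y} (h : MapsTo F S' S) (z : S') :
    (restrictMap F h z : Y) = F z := rfl

omit [TopologicalSpace X] in
/-- Auxiliary statement for the clutching description of bundles over X × S². [folklore] -/
theorem comapRingHom_restrictMap_comp_resHom (F : C(Y', Y)) {S' : Set Y'} {S : Set Y} (h : MapsTo F S' S) :
    (comapRingHom (restrictMap F h)).comp (resHom S) = (resHom S').comp (comapRingHom F) := by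
  rw [resHom, resHom, ← comapRingHom_comp, ← comapRingHom_comp]; rfl

omit [TopologicalSpace X] in
/-- Auxiliary statement for the clutching description of bundles over X × S². [folklore] -/
theorem map_restrictMap_resHom {m k : Type*} (F : C(Y', Y)) {S' : Set Y'} {S : Set Y} (h : MapsTo F S' S) (M : Matrix m k C(Y, ℂ)) :
    (M.map (resHom S)).map (comapRingHom (restrictMap F h)) = (M.map (comapRingHom F)).map (resHom S') := by
  rw [Matrix.map_map, Matrix.map_map, ← RingHom.coe_comp, ← RingHom.coe_comp, comapRingHom_restrictMap_comp_resHom]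

omit [TopologicalSpace X] in
/-- Auxiliary statement for the clutching description of bundles over X × S². [folklore] -/
theorem mapsTo_inter {F : C(Y', Y)} (h₁ : MapsTo F Y₁' Y₁) (h₂ : MapsTo F Y₂' Y₂) : MapsTo F (Y₁' ∩ Y₂') (Y₁ ∩ Y₂) :=
  fun _ hz ↦ ⟨h₁ hz.1, h₂ hz.2⟩

omit [TopologicalSpace X] in
/-- Auxiliary statement for the clutching description of bundles over X × S². [folklore] -/
theorem map_restrictMap_ovl₁ {m k : Type*} {F : C(Y', Y)} (h₁ : MapsTo F Y₁' Y₁) (h₂ : MapsTo F Y₂' Y₂) (M : Matrix m k C(Y₁, ℂ)) :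
    (M.map (ovl₁ Y₁ Y₂)).map (comapRingHom (restrictMap F (mapsTo_inter h₁ h₂))) =
      (M.map (comapRingHom (restrictMap F h₁))).map (ovl₁ Y₁' Y₂') := by
  rw [Matrix.map_map, Matrix.map_map]; rfl

omit [TopologicalSpace X] in
/-- Auxiliary statement for the clutching description of bundles over X × S². [folklore] -/
theorem map_restrictMap_ovl₂ {m k : Type*} {F : C(Y', Y)} (h₁ : MapsTo F Y₁' Y₁) (h₂ : MapsTo F Y₂' Y₂) (M : Matrix m k C(Y₂, ℂ)) :
    (M.map (ovl₂ Y₁ Y₂)).map (comapRingHom (restrictMap F (mapsTo_inter h₁ h₂))) =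
      (M.map (comapRingHom (restrictMap F h₂))).map (ovl₂ Y₁' Y₂') := by
  rw [Matrix.map_map, Matrix.map_map]; rfl

variable {m n₁ n₂ : Type*} [Fintype m] [Fintype n₁] [Fintype n₂]
variable {Q : Matrix m m C(Y, ℂ)} {P₁ : Matrix n₁ n₁ C(Y₁, ℂ)} {P₂ : Matrix n₂ n₂ C(Y₂, ℂ)}

omit [TopologicalSpace X] in
/-- **Base change of a gluing witness** along a map of covered spaces `F : (Y'; Y₁', Y₂') → (Y; Y₁, Y₂)`:
everything pulls back (Husemöller et al., Ch. 3 §7 (7.4), naturality of clutching). [cite: HusemollerEtAl2008, Ch. 3 §7 (7.4)] -/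
def GluingWitness.comap (w : GluingWitness Q P₁ P₂) (F : C(Y', Y)) (h₁ : MapsTo F Y₁' Y₁) (h₂ : MapsTo F Y₂' Y₂) :
    GluingWitness (Q.map (comapRingHom F)) (P₁.map (comapRingHom (restrictMap F h₁))) (P₂.map (comapRingHom (restrictMap F h₂))) where
  x₁ := w.x₁.map (comapRingHom (restrictMap F h₁))
  y₁ := w.y₁.map (comapRingHom (restrictMap F h₁))
  x₂ := w.x₂.map (comapRingHom (restrictMap F h₂))
  y₂ := w.y₂.map (comapRingHom (restrictMap F h₂))
  hxy₁ := by rw [← Matrix.map_mul, w.hxy₁, map_restrictMap_resHom]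
  hyx₁ := by rw [← Matrix.map_mul, w.hyx₁]
  hx₁ := by rw [← Matrix.map_mul, ← Matrix.map_mul, w.hx₁]
  hy₁ := by rw [← Matrix.map_mul, ← Matrix.map_mul, w.hy₁]
  hxy₂ := by rw [← Matrix.map_mul, w.hxy₂, map_restrictMap_resHom]
  hyx₂ := by rw [← Matrix.map_mul, w.hyx₂]
  hx₂ := by rw [← Matrix.map_mul, ← Matrix.map_mul, w.hx₂]
  hy₂ := by rw [← Matrix.map_mul, ← Matrix.map_mul, w.hy₂]

omit [TopologicalSpace X] in
/-- The transition function of the base-changed witness is the pulled-back transition. [cite: HusemollerEtAl2008, Ch. 3 §7 (7.4)] -/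
theorem GluingWitness.g_comap (w : GluingWitness Q P₁ P₂) (F : C(Y', Y)) (h₁ : MapsTo F Y₁' Y₁) (h₂ : MapsTo F Y₂' Y₂) :
    (w.comap F h₁ h₂).g = w.g.map (comapRingHom (restrictMap F (mapsTo_inter h₁ h₂))) := by
  change (w.y₂.map _).map (ovl₂ Y₁' Y₂') * (w.x₁.map _).map (ovl₁ Y₁' Y₂') = _
  rw [GluingWitness.g, Matrix.map_mul, map_restrictMap_ovl₁ h₁ h₂, map_restrictMap_ovl₂ h₁ h₂]

end BaseChange

/-! ### Base change of clutching functions along `f : X' → X` -/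

section BaseChangeX

variable {X' : Type*} [TopologicalSpace X']

/-- `f × id : X' × S² → X × S²`. [folklore] -/
abbrev baseMap (f : C(X', X)) : C(X' × S2r, X × S2r) := f.prodMap (ContinuousMap.id S2r)

omit [TopologicalSpace X] [TopologicalSpace X'] in
/-- Auxiliary statement for the clutching description of bundles over X × S². [folklore] -/
theorem mapsTo_baseMap_pieceUp [TopologicalSpace X] [TopologicalSpace X'] (f : C(X', X)) : MapsTo (baseMap f) (pieceUp X') (pieceUp X) :=
  fun _ hz ↦ ⟨mem_univ _, hz.2⟩

omit [TopologicalSpace X] [TopologicalSpace X'] in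
/-- Auxiliary statement for the clutching description of bundles over X × S². [folklore] -/
theorem mapsTo_baseMap_pieceDn [TopologicalSpace X] [TopologicalSpace X'] (f : C(X', X)) : MapsTo (baseMap f) (pieceDn X') (pieceDn X) :=
  fun _ hz ↦ ⟨mem_univ _, hz.2⟩

/-- `π^*` commutes with base change on the overlap. [folklore] -/
theorem pullA_map (f : C(X', X)) (ζ : Idem C(X, ℂ)) :
    pullA (ζ.map (comapRingHom f)) =
      (pullA ζ).map (comapRingHom (restrictMap (baseMap f) (mapsTo_inter (mapsTo_baseMap_pieceUp f) (mapsTo_baseMap_pieceDn f)))) := by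
  change (ζ.mat.map _).map _ = _
  rw [Matrix.map_map, Matrix.map_map]; rfl

/-- `π₊^*` commutes with base change. [folklore] -/
theorem pullUp_map (f : C(X', X)) (ζ : Idem C(X, ℂ)) :
    pullUp (ζ.map (comapRingHom f)) = (pullUp ζ).map (comapRingHom (restrictMap (baseMap f) (mapsTo_baseMap_pieceUp f))) := by
  change (ζ.mat.map _).map _ = _
  rw [Matrix.map_map, Matrix.map_map]; rfl

/-- `π₋^*` commutes with base change. [folklore] -/
theorem pullDn_map (f : C(X', X)) (ζ : Idem C(X, ℂ)) :
    pullDn (ζ.map (comapRingHom f)) = (pullDn ζ).map (comapRingHom (restrictMap (baseMap f) (mapsTo_baseMap_pieceDn f))) := by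
  change (ζ.mat.map _).map _ = _
  rw [Matrix.map_map, Matrix.map_map]; rfl

omit [TopologicalSpace X] in
/-- Entrywise ring maps preserve triple products (normalised-type helper). [folklore] -/
theorem map_mul_mul_map {R S : Type*} [CommRing R] [CommRing S] {ι : Type*} [Fintype ι] (φ : R →+* S) (A B C : Matrix ι ι R) :
    A.map φ * B.map φ * C.map φ = (A * B * C).map φ := by
  rw [Matrix.map_mul, Matrix.map_mul]

/-- **Base change of a clutching function** along `f : X' → X`: `(f × id|_{S¹})^* u` is a clutching
function for `f^* ζ`. [cite: HusemollerFibreBundles1994, Ch. 11 Notation 2.7] -/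
def ClutchingFn.baseChange {ζ : Idem C(X, ℂ)} (c : ClutchingFn ζ) (f : C(X', X)) : ClutchingFn (ζ.map (comapRingHom f)) where
  u := c.u.map (comapRingHom (restrictMap (baseMap f) (mapsTo_inter (mapsTo_baseMap_pieceUp f) (mapsTo_baseMap_pieceDn f))))
  v := c.v.map (comapRingHom (restrictMap (baseMap f) (mapsTo_inter (mapsTo_baseMap_pieceUp f) (mapsTo_baseMap_pieceDn f))))
  hu := by
    have h := congrArg (fun M ↦ M.map (comapRingHom (restrictMap (baseMap f)
      (mapsTo_inter (mapsTo_baseMap_pieceUp f) (mapsTo_baseMap_pieceDn f))))) c.hu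
    simp only [Matrix.map_mul] at h
    rw [pullA_map]; exact h
  hv := by
    have h := congrArg (fun M ↦ M.map (comapRingHom (restrictMap (baseMap f)
      (mapsTo_inter (mapsTo_baseMap_pieceUp f) (mapsTo_baseMap_pieceDn f))))) c.hv
    simp only [Matrix.map_mul] at h
    rw [pullA_map]; exact h
  huv := by
    have h := congrArg (fun M ↦ M.map (comapRingHom (restrictMap (baseMap f)
      (mapsTo_inter (mapsTo_baseMap_pieceUp f) (mapsTo_baseMap_pieceDn f))))) c.huv
    simp only [Matrix.map_mul] at h
    rw [pullA_map]; exact h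
  hvu := by
    have h := congrArg (fun M ↦ M.map (comapRingHom (restrictMap (baseMap f)
      (mapsTo_inter (mapsTo_baseMap_pieceUp f) (mapsTo_baseMap_pieceDn f))))) c.hvu
    simp only [Matrix.map_mul] at h
    rw [pullA_map]; exact h

/-- Auxiliary statement for the clutching description of bundles over X × S². [folklore] -/
theorem ClutchingFn.baseChange_u {ζ : Idem C(X, ℂ)} (c : ClutchingFn ζ) (f : C(X', X)) :
    (c.baseChange f).u =
      c.u.map (comapRingHom (restrictMap (baseMap f) (mapsTo_inter (mapsTo_baseMap_pieceUp f) (mapsTo_baseMap_pieceDn f)))) := rfl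

/-- **Clutchedness is natural under base change**: `(f × id)^* Q` is clutched from `(f^* ζ, f^* u)`.
[cite: HusemollerFibreBundles1994, Ch. 11 Notation 2.7] -/
theorem IsClutched.baseChange {m : Type*} [Fintype m] {Q : Matrix m m C(X × S2r, ℂ)} {ζ : Idem C(X, ℂ)} {c : ClutchingFn ζ}
    (hQ : IsClutched Q ζ c) (f : C(X', X)) :
    IsClutched (Q.map (comapRingHom (baseMap f))) (ζ.map (comapRingHom f)) (c.baseChange f) := by
  obtain ⟨w, hw⟩ := hQ
  refine ⟨(w.comap (baseMap f) (mapsTo_baseMap_pieceUp f) (mapsTo_baseMap_pieceDn f)).castModels (pullUp_map f ζ).symm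
    (pullDn_map f ζ).symm, ?_⟩
  change (w.comap (baseMap f) (mapsTo_baseMap_pieceUp f) (mapsTo_baseMap_pieceDn f)).g = _
  rw [GluingWitness.g_comap, hw]; rfl

/-- **`bottClass` is natural**: `(f × id)^* [ζ, u] = [f^* ζ, f^* u]`. [cite: HusemollerFibreBundles1994, Ch. 11 Notation 2.7] -/
theorem pullback_baseMap_bottClass [CompactSpace X] [T2Space X] [CompactSpace X'] [T2Space X'] {ζ : Idem C(X, ℂ)}
    (c : ClutchingFn ζ) (f : C(X', X)) :
    pullback (baseMap f) (bottClass ζ c) = bottClass (ζ.map (comapRingHom f)) (c.baseChange f) := by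
  set q : Idem C(X × S2r, ℂ) := Idem.ofMatrix _ (Classical.choose_spec (exists_isClutched ζ c)).isIdempotentElem
  have hq : IsClutched q.mat ζ c := (Classical.choose_spec (exists_isClutched ζ c)).reindex _
  rw [← hq.of_eq, pullback_of]
  exact (hq.baseChange f).of_eq (q.map (comapRingHom (baseMap f)))

end BaseChangeX

/-! ### Homotopy invariance of `[ζ, u]` in the clutching function -/

section Homotopy

/-- The slice inclusion `i_t : X → X × [0,1]`, `x ↦ (x, t)`. [folklore] -/
def sliceIncl (t : I) : C(X, X × I) := (ContinuousMap.id X).prodMk (ContinuousMap.const X t)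

/-- Auxiliary statement for the clutching description of bundles over X × S². [folklore] -/
@[simp] theorem sliceIncl_apply (t : I) (x : X) : sliceIncl t x = (x, t) := rfl

/-- Any two slice inclusions are homotopic. [folklore] -/
theorem sliceIncl_homotopic (s t : I) : (sliceIncl (X := X) s).Homotopic (sliceIncl t) := by
  refine ContinuousMap.Homotopic.prodMk (ContinuousMap.Homotopic.refl _) ?_
  -- constant maps into the path-connected interval are homotopic
  exact ⟨ContinuousMap.Homotopy.mk
    ⟨fun p ↦ ⟨(1 - (p.1 : ℝ)) * s + (p.1 : ℝ) * t, by
        constructor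
        · nlinarith [p.1.2.1, p.1.2.2, s.2.1, s.2.2, t.2.1, t.2.2]
        · nlinarith [p.1.2.1, p.1.2.2, s.2.1, s.2.2, t.2.1, t.2.2]⟩, by fun_prop⟩
    (fun x ↦ by ext; simp) (fun x ↦ by ext; simp)⟩

/-- `bottClass` only depends on the clutching matrix `u`. [folklore] -/
theorem bottClass_congr_u [CompactSpace X] [T2Space X] {ζ : Idem C(X, ℂ)} {c c' : ClutchingFn ζ} (h : c.u = c'.u) :
    bottClass ζ c = bottClass ζ c' := by
  have hQ := Classical.choose_spec (exists_isClutched ζ c)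
  have hQ' : IsClutched (Classical.choose (exists_isClutched ζ c)) ζ c' := by
    obtain ⟨w, hw⟩ := hQ; exact ⟨w, hw.trans h⟩
  exact hQ'.of_ofMatrix_eq

variable [CompactSpace X] [T2Space X]

/-- **Homotopy invariance of the Bott class** (Husemöller, Ch. 10 §7 / Ch. 11 (2.6): homotopic
clutching maps give isomorphic bundles): for a clutching function `U` of `pr₁^* ζ` over the base
`X × [0,1]` — a homotopy of clutching functions of `ζ` — the Bott classes of the slices `U|_{t=0}`
and `U|_{t=1}` agree. Proof: both are pull-backs of `[pr₁^*ζ, U] ∈ K⁰((X × [0,1]) × S²)` along the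
homotopic maps `i₀ × id ≃ i₁ × id`. [cite: HusemollerFibreBundles1994, Ch. 11 (2.6)] -/
theorem bottClass_slice_eq (ζ : Idem C(X × I, ℂ)) (U : ClutchingFn ζ) (s t : I) :
    bottClass (ζ.map (comapRingHom (sliceIncl s))) (U.baseChange (sliceIncl s)) =
      bottClass (ζ.map (comapRingHom (sliceIncl t))) (U.baseChange (sliceIncl t)) := by
  rw [← pullback_baseMap_bottClass, ← pullback_baseMap_bottClass,
    pullback_eq_of_homotopic ((sliceIncl_homotopic s t).prodMap (ContinuousMap.Homotopic.refl (ContinuousMap.id S2r)))]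

/-- **Homotopic clutching functions have equal Bott classes** (user form): if `c₀`, `c₁` are the
slices at `0` and `1` of a clutching function `U` of `pr₁^* ζ` over `X × [0,1]`, then
`[ζ, u₀] = [ζ, u₁]`. [cite: HusemollerFibreBundles1994, Ch. 11 (2.6)] -/
theorem bottClass_eq_of_homotopy (ζ : Idem C(X, ℂ)) (c₀ c₁ : ClutchingFn ζ)
    (U : ClutchingFn (ζ.map (comapRingHom (ContinuousMap.fst : C(X × I, X)))))
    (h₀ : (U.baseChange (sliceIncl 0)).u = c₀.u) (h₁ : (U.baseChange (sliceIncl 1)).u = c₁.u) :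
    bottClass ζ c₀ = bottClass ζ c₁ := by
  have e := bottClass_slice_eq (ζ.map (comapRingHom (ContinuousMap.fst : C(X × I, X)))) U 0 1
  have e₀ : bottClass _ (U.baseChange (sliceIncl 0)) = bottClass ζ c₀ := bottClass_congr_u h₀
  have e₁ : bottClass _ (U.baseChange (sliceIncl 1)) = bottClass ζ c₁ := bottClass_congr_u h₁
  exact e₀.symm.trans (e.trans e₁)

end Homotopy

end Literature.AlgebraicTopology.KTheory

end
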